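import Literature.AnabelianGeometry.SemiGraphs.ArithEdgeLikeNested
import HarnessLib

/-!
# [SemiAnbd] Theorem 5.4 (ii): the two hosts of an edge-like subgroup — version compatible with the
# arithmetic action of `Π_A` on `𝔾` (sub-DAG Thm 5.4, row T54-4c v2)

Mochizuki, *Semi-graphs of anabelioids*, Publ. RIMS **42** (2006), §5, Theorem 5.4 p. 66
[cite: MochizukiSemiAnbd2006, Thm 5.4 (ii), p. 66], over abc-iut-L3-t3's `ArithMaximalCompact.lean`.

PROOF-ONLY sequel to `ArithEdgeLikeNested.lean` (seat abc-iut-w4-d098).  That file derives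
`hβ₁`/(U)/`hβ₂`/`hEV` of the Thm 5.4 interface menu from a verticial-rigidity binder `hVR`
demanding `v′ = v` whenever `h·Π_{𝔊,v′}·h⁻¹ = Π_{𝔊,v}` — which real arithmetic data violate as soon
as `Π_A` moves a vertex of `𝔾` (Def 5.1 (i); T54 coordinator rulings R19/R22: for produced data
`hVR` holds iff the base action of `Π_A` fixes every vertex of `𝔾`, so that file is BOOKED as this
special case, e.g. split stable models as in Example 5.6).  Here the SAME conclusions are derived
from the `Π_A`-compatible form: if `h·Π_{𝔊,v′}·h⁻¹ = Π_{𝔊,v}` then `h` carries every branch group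
at `v′` onto a `Π_{𝔊,v}`-conjugate of a branch group at `v`, and never onto the OTHER branch of
the same edge ("the arithmetic actions on the underlying graphs do not switch the branches of
any edge", the hypothesis of Thm 5.4) — satisfied by the decomposition groups of the action of
`Π^temp_𝔊` on the universal covering tree (`h·ṽ′ = ṽ`; the lifts of one branch at `ṽ` form one
stabiliser orbit).
Results: `false_of_hosts_eq_of_action`, `exists_hosts_of_isEdgeLike_of_action` (`hβ₁`),
`edgeLike_eq_inf_of_le_of_le_of_action` ((U)), `edgeLike_eq_of_le_of_action` (`hβ₂`),
`exists_eq_inf_of_isEdgeLike_of_action` (`hEV`).  Pure group theory; nothing here asserts an input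
for any data, and nothing bears on [IUTchIII] Cor. 3.12.
-/

namespace Literature.AnabelianGeometry.SemiGraphs

universe u u' w w'

variable {Gtp : Type u} [Group Gtp] [TopologicalSpace Gtp]
variable {PA : Type u'} [Group PA] [TopologicalSpace PA]
variable {V : Type w} {B : Type w'}
variable {D : DecompositionData Gtp V B} {aug : Gtp →* PA}

/-! ### Conjugation bookkeeping (local) -/

omit [TopologicalSpace Gtp] in
/-- Membership in a conjugate subgroup. [folklore] -/
private theorem mem_conjSubgroup_iff {g x : Gtp} {K : Subgroup Gtp} :
    x ∈ conjSubgroup g K ↔ g⁻¹ * x * g ∈ K := by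
  constructor
  · rintro ⟨y, hy, rfl⟩
    simpa [MulAut.conj_apply, mul_assoc] using hy
  · intro h
    exact ⟨g⁻¹ * x * g, h, by simp [MulAut.conj_apply, mul_assoc]⟩

omit [TopologicalSpace Gtp] in
/-- Conjugation by a product is iterated conjugation. [folklore] -/
private theorem conjSubgroup_mul' (g h : Gtp) (K : Subgroup Gtp) :
    conjSubgroup (g * h) K = conjSubgroup g (conjSubgroup h K) := by
  ext x
  simp only [mem_conjSubgroup_iff, mul_inv_rev, mul_assoc]

omit [TopologicalSpace Gtp] in
/-- Conjugation by `1` is the identity. [folklore] -/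
private theorem conjSubgroup_one' (K : Subgroup Gtp) : conjSubgroup 1 K = K := by
  ext x
  simp [mem_conjSubgroup_iff]

omit [TopologicalSpace Gtp] in
/-- Conjugation by `g⁻¹` undoes conjugation by `g`. [folklore] -/
private theorem conjSubgroup_inv_conjSubgroup (g : Gtp) (K : Subgroup Gtp) :
    conjSubgroup g⁻¹ (conjSubgroup g K) = K := by
  rw [← conjSubgroup_mul', inv_mul_cancel, conjSubgroup_one']

omit [TopologicalSpace Gtp] in
/-- Conjugation is monotone. [folklore] -/
private theorem conjSubgroup_mono' (g : Gtp) {K L : Subgroup Gtp} (h : K ≤ L) :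
    conjSubgroup g K ≤ conjSubgroup g L :=
  Subgroup.map_mono h

omit [TopologicalSpace Gtp] in
/-- Conjugation reflects inclusions. [folklore] -/
private theorem conjSubgroup_le_iff' {g : Gtp} {K L : Subgroup Gtp} :
    conjSubgroup g K ≤ conjSubgroup g L ↔ K ≤ L := by
  refine ⟨fun h => ?_, conjSubgroup_mono' g⟩
  have h' := conjSubgroup_mono' g⁻¹ h
  rwa [conjSubgroup_inv_conjSubgroup, conjSubgroup_inv_conjSubgroup] at h'

omit [TopologicalSpace Gtp] in
/-- Conjugation by a fixed element is injective on subgroups. [folklore] -/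
private theorem conjSubgroup_inj' {g : Gtp} {K L : Subgroup Gtp} :
    conjSubgroup g K = conjSubgroup g L ↔ K = L := by
  refine ⟨fun h => le_antisymm ?_ ?_, fun h => h ▸ rfl⟩
  · exact conjSubgroup_le_iff'.mp h.le
  · exact conjSubgroup_le_iff'.mp h.ge

omit [TopologicalSpace Gtp] in
/-- A subgroup is stable under conjugation by its own elements. [folklore] -/
private theorem conjSubgroup_eq_self_of_mem' {g : Gtp} {K : Subgroup Gtp} (hg : g ∈ K) :
    conjSubgroup g K = K := by
  ext x
  rw [mem_conjSubgroup_iff]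
  constructor
  · intro h
    have := K.mul_mem (K.mul_mem hg h) (K.inv_mem hg)
    simpa [mul_assoc] using this
  · intro h
    exact K.mul_mem (K.mul_mem (K.inv_mem hg) h) hg

/-! ### The two hosts of an edge-like subgroup -/

section HostsAction

variable (hR : VerticialEdgeLikeCompactAmpleStatement D aug) (hEst : IsTotallyArithEstranged D aug)
  (hconj : ∀ b b' : B, D.edgeOf b = D.edgeOf b' → ∃ h : Gtp, D.brGp b' = conjSubgroup h (D.brGp b))
  (hgraph : ∀ b : B, ∃ v : V, D.abut b = some v)
  (htwo : ∀ b : B, ∃ b' : B, b' ≠ b ∧ D.edgeOf b' = D.edgeOf b)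
include hR hEst hconj hgraph htwo

omit hconj hgraph htwo in
/-- **The two branches of one edge have distinct hosts**: if `b₂ ≠ b` are branches of one edge
(`b ↦ v`, `b₂ ↦ v₂`, `Π_{𝔊,b} = c·Π_{𝔊,b₂}·c⁻¹`) then `Π_{𝔊,v} ≠ c·Π_{𝔊,v₂}·c⁻¹`: otherwise, by
verticial rigidity, `c` carries `Π_{𝔊,b₂}` to a `Π_{𝔊,v}`-conjugate of a branch group at `v`, which
estrangement forces to be that of `b` itself — a branch switching.
[cite: MochizukiSemiAnbd2006, Def 5.3 (ii), p. 65] -/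
theorem false_of_hosts_eq_of_action
    (hVR : ∀ (v v' : V) (h : Gtp), conjSubgroup h (D.vertGp v') = D.vertGp v →
      ∀ b' : B, D.abut b' = some v' → ∃ (b : B) (u : Gtp), D.abut b = some v ∧ u ∈ D.vertGp v ∧
      conjSubgroup h (D.brGp b') = conjSubgroup u (D.brGp b) ∧ (D.edgeOf b = D.edgeOf b' → b = b'))
    {b b₂ : B} {v v₂ : V} (hne : b₂ ≠ b)
    (he : D.edgeOf b₂ = D.edgeOf b) (hb : D.abut b = some v) (hb₂ : D.abut b₂ = some v₂) {c : Gtp}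
    (hc : D.brGp b = conjSubgroup c (D.brGp b₂))
    (hV : conjSubgroup c (D.vertGp v₂) = D.vertGp v) : False := by
  obtain ⟨b₀, u, hb₀, hu, hcu, hsw⟩ := hVR v v₂ c hV b₂ hb₂
  obtain ⟨hbb, -⟩ := brGp_eq_conj_of_le hR hEst hb hb₀ hu (hc.trans hcu).le
  subst hbb
  exact hne (hsw he.symm).symm

/-- **Every edge-like subgroup lies in two DISTINCT verticial subgroups** — the hosts
`g·Π_{𝔊,v}·g⁻¹`, `g c·Π_{𝔊,v₂}·(g c)⁻¹` of the two branches `b ↦ v`, `b₂ ↦ v₂` of its edge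
(`Π_{𝔊,b} = c·Π_{𝔊,b₂}·c⁻¹`); they are distinct (`false_of_hosts_eq_of_action`).
This is the input `hβ₁` of `ArithEdgeLikeInfVerticial.lean` (abc-iut-w4-d085).
[cite: MochizukiSemiAnbd2006, Thm 5.4 (ii), p. 66] -/
theorem exists_hosts_of_isEdgeLike_of_action
    (hVR : ∀ (v v' : V) (h : Gtp), conjSubgroup h (D.vertGp v') = D.vertGp v →
      ∀ b' : B, D.abut b' = some v' → ∃ (b : B) (u : Gtp), D.abut b = some v ∧ u ∈ D.vertGp v ∧
      conjSubgroup h (D.brGp b') = conjSubgroup u (D.brGp b) ∧ (D.edgeOf b = D.edgeOf b' → b = b'))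
    {E : Subgroup Gtp} (hE : IsEdgeLike D E) :
    ∃ W₁ W₂ : Subgroup Gtp, IsVerticial D W₁ ∧ IsVerticial D W₂ ∧ W₁ ≠ W₂ ∧ E ≤ W₁ ∧ E ≤ W₂ := by
  obtain ⟨b, g, rfl⟩ := hE
  obtain ⟨v, hb⟩ := hgraph b
  obtain ⟨b₂, hne, he⟩ := htwo b
  obtain ⟨v₂, hb₂⟩ := hgraph b₂
  obtain ⟨c, hc⟩ := hconj b₂ b he
  refine ⟨conjSubgroup g (D.vertGp v), conjSubgroup (g * c) (D.vertGp v₂), ⟨v, g, rfl⟩,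
    ⟨v₂, g * c, rfl⟩, ?_, conjSubgroup_mono' g (D.brGp_le_vertGp b v hb), ?_⟩
  · intro heq
    rw [conjSubgroup_mul', conjSubgroup_inj'] at heq
    exact false_of_hosts_eq_of_action hR hEst hVR hne he hb hb₂ hc heq.symm
  · rw [hc, ← conjSubgroup_mul']
    exact conjSubgroup_mono' _ (D.brGp_le_vertGp b₂ v₂ hb₂)

omit hconj hgraph htwo in
/-- The same-host step: if `E = g·Π_{𝔊,b}·g⁻¹ ⊆ L = k·Π_{𝔊,b″}·k⁻¹` (`b ↦ v`, `b″ ↦ v″`) and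
the hosts coincide, `k·Π_{𝔊,v″}·k⁻¹ = g·Π_{𝔊,v}·g⁻¹`, then `L = E` (verticial rigidity makes
`g⁻¹·L·g` a `Π_{𝔊,v}`-conjugate of a branch group at `v`; then estrangement).
[cite: MochizukiSemiAnbd2006, Def 5.3 (ii), p. 65] -/
private theorem conj_brGp_eq_of_le_of_hosts_eq₂
    (hVR : ∀ (v v' : V) (h : Gtp), conjSubgroup h (D.vertGp v') = D.vertGp v →
      ∀ b' : B, D.abut b' = some v' → ∃ (b : B) (u : Gtp), D.abut b = some v ∧ u ∈ D.vertGp v ∧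
      conjSubgroup h (D.brGp b') = conjSubgroup u (D.brGp b) ∧ (D.edgeOf b = D.edgeOf b' → b = b'))
    {b b'' : B} {v v'' : V} (hb : D.abut b = some v)
    (hb'' : D.abut b'' = some v'') {g k : Gtp}
    (hle : conjSubgroup g (D.brGp b) ≤ conjSubgroup k (D.brGp b''))
    (hhost : conjSubgroup k (D.vertGp v'') = conjSubgroup g (D.vertGp v)) :
    conjSubgroup k (D.brGp b'') = conjSubgroup g (D.brGp b) := by
  have h1 : conjSubgroup (g⁻¹ * k) (D.vertGp v'') = D.vertGp v := by
    rw [conjSubgroup_mul', hhost, conjSubgroup_inv_conjSubgroup]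
  obtain ⟨b₀, u, hb₀, hu, hcu, -⟩ := hVR v v'' (g⁻¹ * k) h1 b'' hb''
  have hle' : D.brGp b ≤ conjSubgroup u (D.brGp b₀) := by
    have := conjSubgroup_mono' g⁻¹ hle
    rwa [conjSubgroup_inv_conjSubgroup, ← conjSubgroup_mul', hcu] at this
  obtain ⟨-, heq⟩ := brGp_eq_conj_of_le hR hEst hb hb₀ hu hle'
  have := congrArg (conjSubgroup g) (hcu.trans heq)
  rwa [← conjSubgroup_mul', mul_inv_cancel_left] at this

/-- **An edge-like subgroup contained in two distinct verticial subgroups is their intersection**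
(Thm 5.4 (ii), second sentence, the geometric content): by (i) `W₁ ⊓ W₂ =: L` is edge-like and
contains `E`; the host of `E` is `W₁` or `W₂`; if a host of `L` (via either branch of its edge)
equals the host of `E`, estrangement at that vertex gives `L = E`; otherwise both hosts of `L`
equal the other `Wᵢ`, making the edge of `L` a loop with conjugate branch groups — excluded by
estrangement.
[cite: MochizukiSemiAnbd2006, Thm 5.4 (ii), p. 66] -/
theorem edgeLike_eq_inf_of_le_of_le_of_action
    (hVR : ∀ (v v' : V) (h : Gtp), conjSubgroup h (D.vertGp v') = D.vertGp v →
      ∀ b' : B, D.abut b' = some v' → ∃ (b : B) (u : Gtp), D.abut b = some v ∧ u ∈ D.vertGp v ∧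
      conjSubgroup h (D.brGp b') = conjSubgroup u (D.brGp b) ∧ (D.edgeOf b = D.edgeOf b' → b = b'))
    (hI : ArithMaximalCompactStatementI D aug)
    {E W₁ W₂ : Subgroup Gtp} (hE : IsEdgeLike D E) (hW₁ : IsVerticial D W₁)
    (hW₂ : IsVerticial D W₂) (hne : W₁ ≠ W₂) (h₁ : E ≤ W₁) (h₂ : E ≤ W₂) : E = W₁ ⊓ W₂ := by
  obtain ⟨hEc, hEa⟩ := hR E (Or.inr hE)
  obtain ⟨-, hI2⟩ := hI E hEc hEa
  obtain ⟨honly, hL⟩ := hI2 W₁ W₂ hW₁ hW₂ hne h₁ h₂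
  obtain ⟨b, g, rfl⟩ := hE
  obtain ⟨b'', k, hLk⟩ := hL
  obtain ⟨v, hb⟩ := hgraph b
  obtain ⟨v'', hb''⟩ := hgraph b''
  have hEL : conjSubgroup g (D.brGp b) ≤ conjSubgroup k (D.brGp b'') := hLk ▸ le_inf h₁ h₂
  -- the host of `E` and the first host of `L`
  have hHE := honly _ ⟨v, g, rfl⟩ (conjSubgroup_mono' g (D.brGp_le_vertGp b v hb))
  have hL1 : conjSubgroup k (D.brGp b'') ≤ conjSubgroup k (D.vertGp v'') :=
    conjSubgroup_mono' k (D.brGp_le_vertGp b'' v'' hb'')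
  have hHL := honly _ ⟨v'', k, rfl⟩ (hEL.trans hL1)
  by_cases hs : conjSubgroup k (D.vertGp v'') = conjSubgroup g (D.vertGp v)
  · rw [hLk]; exact (conj_brGp_eq_of_le_of_hosts_eq₂ hR hEst hVR hb hb'' hEL hs).symm
  -- the second host of `L`, through the other branch of its edge
  obtain ⟨b₂, hb₂ne, he⟩ := htwo b''
  obtain ⟨v₂, hb₂⟩ := hgraph b₂
  obtain ⟨c, hc⟩ := hconj b₂ b'' he
  have hLk' : conjSubgroup k (D.brGp b'') = conjSubgroup (k * c) (D.brGp b₂) := by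
    rw [hc, conjSubgroup_mul']
  have hL2 : conjSubgroup (k * c) (D.brGp b₂) ≤ conjSubgroup (k * c) (D.vertGp v₂) :=
    conjSubgroup_mono' _ (D.brGp_le_vertGp b₂ v₂ hb₂)
  have hHL2 := honly _ ⟨v₂, k * c, rfl⟩ ((hEL.trans_eq hLk').trans hL2)
  by_cases hs2 : conjSubgroup (k * c) (D.vertGp v₂) = conjSubgroup g (D.vertGp v)
  · rw [hLk, hLk']
    exact (conj_brGp_eq_of_le_of_hosts_eq₂ hR hEst hVR hb hb₂
      (hEL.trans_eq hLk') hs2).symm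
  -- both hosts of `L` differ from the host of `E`: they coincide, and the edge of `L` is a loop
  -- with conjugate branch groups — impossible
  exfalso
  have hhosts : conjSubgroup k (D.vertGp v'') = conjSubgroup (k * c) (D.vertGp v₂) := by
    rcases hHE with hE1 | hE2
    · rcases hHL with hl | hl
      · exact absurd (hl.trans hE1.symm) hs
      · rcases hHL2 with hl2 | hl2
        · exact absurd (hl2.trans hE1.symm) hs2
        · exact hl.trans hl2.symm
    · rcases hHL with hl | hl
      · rcases hHL2 with hl2 | hl2
        · exact hl.trans hl2.symm
        · exact absurd (hl2.trans hE2.symm) hs2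
      · exact absurd (hl.trans hE2.symm) hs
  rw [conjSubgroup_mul', conjSubgroup_inj'] at hhosts
  exact false_of_hosts_eq_of_action hR hEst hVR hb₂ne he hb'' hb₂ hc hhosts.symm

/-- **Nested edge-like subgroups are equal** (`hβ₂` of the Thm 5.4 interface menu): `E ⊆ E′`
edge-like; `E′` lies in two distinct verticial subgroups (`exists_hosts_of_isEdgeLike`), hence so
does `E`, and `E = W₁ ⊓ W₂ ⊇ E′`. [cite: MochizukiSemiAnbd2006, Thm 5.4 (ii), p. 66] -/
theorem edgeLike_eq_of_le_of_action
    (hVR : ∀ (v v' : V) (h : Gtp), conjSubgroup h (D.vertGp v') = D.vertGp v →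
      ∀ b' : B, D.abut b' = some v' → ∃ (b : B) (u : Gtp), D.abut b = some v ∧ u ∈ D.vertGp v ∧
      conjSubgroup h (D.brGp b') = conjSubgroup u (D.brGp b) ∧ (D.edgeOf b = D.edgeOf b' → b = b'))
    (hI : ArithMaximalCompactStatementI D aug) {E E' : Subgroup Gtp}
    (hE : IsEdgeLike D E) (hE' : IsEdgeLike D E') (hle : E ≤ E') : E = E' := by
  obtain ⟨W₁, W₂, hW₁, hW₂, hne, h₁, h₂⟩ :=
    exists_hosts_of_isEdgeLike_of_action hR hEst hconj hgraph htwo hVR hE'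
  have hEinf := edgeLike_eq_inf_of_le_of_le_of_action hR hEst hconj hgraph htwo hVR hI hE hW₁
    hW₂ hne (hle.trans h₁) (hle.trans h₂)
  exact le_antisymm hle (hEinf ▸ le_inf h₁ h₂)

/-- **Every edge-like subgroup is the intersection of two distinct verticial subgroups**
(Thm 5.4 (ii), second sentence; the input `hEV` of `arithMaximalCompactStatementII_of'`, here
derived from (i), Rmk 5.3.1, estrangement and the four data-level inputs).
[cite: MochizukiSemiAnbd2006, Thm 5.4 (ii), p. 66] -/
theorem exists_eq_inf_of_isEdgeLike_of_action
    (hVR : ∀ (v v' : V) (h : Gtp), conjSubgroup h (D.vertGp v') = D.vertGp v →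
      ∀ b' : B, D.abut b' = some v' → ∃ (b : B) (u : Gtp), D.abut b = some v ∧ u ∈ D.vertGp v ∧
      conjSubgroup h (D.brGp b') = conjSubgroup u (D.brGp b) ∧ (D.edgeOf b = D.edgeOf b' → b = b'))
    (hI : ArithMaximalCompactStatementI D aug)
    {K : Subgroup Gtp} (hK : IsEdgeLike D K) :
    ∃ W₁ W₂ : Subgroup Gtp, IsVerticial D W₁ ∧ IsVerticial D W₂ ∧ W₁ ≠ W₂ ∧ K = W₁ ⊓ W₂ := by
  obtain ⟨W₁, W₂, hW₁, hW₂, hne, h₁, h₂⟩ :=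
    exists_hosts_of_isEdgeLike_of_action hR hEst hconj hgraph htwo hVR hK
  exact ⟨W₁, W₂, hW₁, hW₂, hne,
    edgeLike_eq_inf_of_le_of_le_of_action hR hEst hconj hgraph htwo hVR hI hK hW₁ hW₂ hne h₁ h₂⟩

end HostsAction

end Literature.AnabelianGeometry.SemiGraphs
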